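import Summits.ABC.IUTFork.Cor312GenuineKWildExactUnit
import Summits.ABC.IUTFork.Cor312GenuineKWildExactSplit
import HarnessLib

/-!
# [IUTchIII] Cor. 3.12, branch C / R-W window table — the wild local type at a pole `p ∣ t` DECIDED by ONE congruence:
# `e(K_{x₀}/ℚ_p) = p(p−1)·r·l` if `v_p(u^{p−1} − 1) = 1`, and `= (p−1)·r·l` otherwise (`u = j⁻¹p^{−2t}`, `r = p′/gcd(p′, t)`)

PROOF-ONLY support file (D-0012; 0 definitions, 0 `Prop` facts) of the abc-iut cell (R-W «WINDOW Θ-SIDE INEQUALITY», seat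
abc-iut-W-neg-1 gen 3; GAP G-Wnum2-1 (i)). TAKES NO SIDE on [IUTchIII] Cor. 3.12 (S. Mochizuki, *Inter-universal Teichmüller
theory III*, Cor. 3.12 p. 173–174) or on any author.

The two landed exact types at a pole of `j(q₀)` of order `2t` with `p ∣ t` (`p ∈ {3, 5}`, `p ≠ l`) —
`GenuineK.absRamificationIdx_kOf_eq_wildUnit_ratPoint` (W2: `v_p(u^{p−1} − 1) = 1` ⇒ `e = p(p−1)·r·l`, gen 2) and
`GenuineK.absRamificationIdx_kOf_eq_wildSplit_ratPoint` (SPLIT: `u^{p−1} = 1 ∨ v_p(u^{p−1} − 1) ≥ 2` ⇒ `e = (p−1)·r·l`, gen 3) — are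
EXHAUSTIVE: for the rational unit `u = (j(q₀)⁻¹)/p^{2t}` (`v_p(u) = 0`) Fermat's little theorem gives `u^{p−1} ≡ 1 (mod p)`, i.e.
`u^{p−1} = 1` or `v_p(u^{p−1} − 1) ≥ 1` (`padicValRat_pow_sub_one_sub_one_of_padicValRat_eq_zero`, via `ℤ_p → 𝔽_p`). Hence ONE
theorem deciding the local type at EVERY `p ∣ t` pole by ONE congruence on the rational datum:

* **`GenuineK.absRamificationIdx_kOf_eq_wild_ite_ratPoint`** —
  `e(K_{x₀}/ℚ_p) = (if v_p(u^{p−1} − 1) = 1 then p(p − 1) else p − 1)·(p′/gcd(p′, t))·l`;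
* `GenuineK.prime_dvd_absRamificationIdx_kOf_iff_ratPoint` — at such a pole, **`p ∣ e(K_{x₀}/ℚ_p) ↔ v_p(u^{p−1} − 1) = 1`**
  (wild ramification ⟺ the Kummer class of the Tate parameter is non-trivial on inertia; Serre 1972 §1.12, Serre *Cours* II §3.3).

With gen 2's W1 theorem (`p ∤ t` ⇒ `e = p(p−1)·r·l`, `Cor312GenuineKWildExact`) the wild local type of a rational-point genuine
datum at `p ∈ {3, 5}` is a FUNCTION of `(t mod 15p, u mod p²)` — W-num-2's N1-WILD-EXACT table in the kernel.

HONEST FRAMING: bookkeeping over OUR typed objects (classical Tate-curve and local-field theory); nothing here bears on the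
printed inequality of [IUTchIII] Cor. 3.12 or on the number-level `Cor22.Cor312AtDatum`; typed ≠ proved; instantiated ≠ endorsed.
[cite: Serre1972, §1.11–§1.12] [cite: Serre1973, Ch. II §3.3] [cite: Mochizuki2012, IUTchIV Thm. 1.10 p. 22]
[claim: Mochizuki2012, status: disputed] for every IUT quotation.
-/

noncomputable section

open NumberField IsDedekindDomain

namespace Summit.ABC.IUTFork.Conditional

open Thm311 Thm311.Real Cor312 Cor312Prov Literature.IUT.LogVolume Literature.IUT.HodgeTheaters
  Literature.IUT.LogThetaLattice Literature.NumberTheory.NumberFields Literature.NumberTheory.DiophantineGeometry.GenEll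
  Literature.NumberTheory.DiophantineGeometry Literature.NumberTheory.EllipticCurves

/-! ## 0. Fermat's little theorem for a rational `p`-adic unit -/

/-- **Fermat for a rational `p`-adic unit**: `u ∈ ℚ`, `u ≠ 0`, `v_p(u) = 0` ⇒ `u^{p−1} = 1` or `v_p(u^{p−1} − 1) ≥ 1`
(reduce the unit `u ∈ ℤ_p^×` to `𝔽_p^×`, where `x^{p−1} = 1`). [folklore] [cite: Serre1973, Ch. II §3.1 Prop. 7] -/
theorem GenuineK.padicValRat_pow_sub_one_sub_one_of_padicValRat_eq_zero {p : ℕ} [hp : Fact p.Prime] {u : ℚ}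
    (hu0 : u ≠ 0) (hu : padicValRat p u = 0) :
    u ^ (p - 1) = 1 ∨ 1 ≤ padicValRat p (u ^ (p - 1) - 1) := by
  by_cases h1 : u ^ (p - 1) - 1 = 0
  · exact Or.inl (sub_eq_zero.mp h1)
  right
  have hp1 : (1 : ℚ) < p := by exact_mod_cast hp.out.one_lt
  -- `u` is a unit of `ℤ_p`
  have hnu : ‖((u : ℚ) : ℚ_[p])‖ = 1 := by
    rw [Padic.eq_padicNorm, padicNorm.eq_zpow_of_nonzero hu0, hu, neg_zero, zpow_zero, Rat.cast_one]
  set uz : ℤ_[p] := ⟨((u : ℚ) : ℚ_[p]), hnu.le⟩ with huz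
  have hunit : IsUnit uz := PadicInt.isUnit_iff.mpr (by rw [PadicInt.norm_def]; exact hnu)
  -- residue in `𝔽_p`: `ū^{p−1} = 1`
  have hres : PadicInt.toZMod (uz ^ (p - 1) - 1) = 0 := by
    rw [map_sub, map_pow, map_one, ZMod.pow_card_sub_one_eq_one (hunit.map PadicInt.toZMod).ne_zero, sub_self]
  have hmem : uz ^ (p - 1) - 1 ∈ (Ideal.span {((p : ℕ) : ℤ_[p]) ^ 1} : Ideal ℤ_[p]) := by
    rw [pow_one, ← PadicInt.maximalIdeal_eq_span_p, ← PadicInt.ker_toZMod]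
    exact hres
  have hnorm : ‖uz ^ (p - 1) - 1‖ ≤ (p : ℝ) ^ (-(1 : ℕ) : ℤ) := (PadicInt.norm_le_pow_iff_mem_span_pow _ 1).mpr hmem
  -- back to `ℚ`
  have hq : padicNorm p (u ^ (p - 1) - 1) ≤ (p : ℚ) ^ (-1 : ℤ) := by
    have hcast : ((((u ^ (p - 1) - 1 : ℚ)) : ℚ_[p])) = ((uz ^ (p - 1) - 1 : ℤ_[p]) : ℚ_[p]) := by
      rw [PadicInt.coe_sub, PadicInt.coe_pow, PadicInt.coe_one, huz]; push_cast; rfl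
    have h : ‖(((u ^ (p - 1) - 1 : ℚ)) : ℚ_[p])‖ ≤ (p : ℝ) ^ (-1 : ℤ) := by
      rw [hcast, PadicInt.padic_norm_e_of_padicInt]; exact_mod_cast hnorm
    rw [Padic.eq_padicNorm] at h
    have h' : ((padicNorm p (u ^ (p - 1) - 1) : ℚ) : ℝ) ≤ (((p : ℚ) ^ (-1 : ℤ) : ℚ) : ℝ) := by
      simpa only [Rat.cast_zpow, Rat.cast_natCast] using h
    exact Rat.cast_le.mp h'
  rw [padicNorm.eq_zpow_of_nonzero h1] at hq
  have := (zpow_le_zpow_iff_right₀ hp1).mp hq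
  linarith

/-! ## 1. The local type at a `p ∣ t` pole, decided -/

/-- **THE WILD LOCAL TYPE AT A `p ∣ t` POLE, DECIDED BY ONE CONGRUENCE:
`e(K_{x₀}/ℚ_p) = (if v_p(u^{p−1} − 1) = 1 then p(p − 1) else p − 1)·(p′/gcd(p′, t))·l`** at every fibre point `x₀ ∣ p ∈ {3, 5}`
(`p ≠ l`, `{p, p′} = {3, 5}`) of the pilot datum of a genuine Θ-volume datum at `(ratPoint q₀, l)` over a pole of `j(q₀)` of order `2t`
with `p ∣ t`, where `u = (j(q₀)⁻¹)/p^{2t}`: the W2 case is gen 2's `GenuineK.absRamificationIdx_kOf_eq_wildUnit_ratPoint`, the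
complementary case is SPLIT by Fermat (`u^{p−1} = 1 ∨ v_p(u^{p−1} − 1) ≥ 2`) and is gen 3's
`GenuineK.absRamificationIdx_kOf_eq_wildSplit_ratPoint`. [cite: Serre1972, §1.11–§1.12] [cite: Serre1973, Ch. II §3.3]
[cite: Mochizuki2012, IUTchI Ex. 3.2 (iv) p. 71; IUTchIV Thm. 1.10 p. 22] [claim: Mochizuki2012, status: disputed] -/
theorem GenuineK.absRamificationIdx_kOf_eq_wild_ite_ratPoint {q₀ : ℚ} {l : ℕ} (T : Cor22.ThetaVolumeDatumAt (ratPoint q₀) l)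
    (pp : Nat.Primes) {p' : ℕ} (hpq : ((pp : ℕ) = 3 ∧ p' = 5) ∨ ((pp : ℕ) = 5 ∧ p' = 3)) (hpl : (pp : ℕ) ≠ l)
    {t : ℕ} (ht : 0 < t) (hpt : (pp : ℕ) ∣ t)
    (hpole : ∀ v : HeightOneSpectrum (𝓞 ℚ), Rat.HeightOneSpectrum.natGenerator v = pp →
      Literature.IUT.LogVolume.ord ℚ v (Cor22.jInv q₀) = -(2 * (t : ℤ))) :
    letI := T.instFieldF; letI := T.instNumberFieldF; letI := T.instAlgebraF; letI := T.instFieldK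
    letI := T.instNumberFieldK; letI := T.instAlgebraK; letI := T.instFieldFbar; letI := T.instAlgebraFbar
    letI := T.instAlgebraKFbar; letI := T.instIsElliptic
    haveI : Fact (pp : ℕ).Prime := ⟨pp.2⟩
    ∀ x₀ : (thetaIndex (pilotDataOfK T.D T.K)).Fibre (.inr pp),
      absRamificationIdx (pp : ℕ) (kOf (pilotDataOfK T.D T.K) pp.1 x₀) =
        (if padicValRat pp ((((Cor22.jInv q₀)⁻¹ / ((pp : ℕ) : ℚ) ^ (2 * t)) ^ ((pp : ℕ) - 1) - 1)) = 1
          then (pp : ℕ) * (pp - 1) else (pp - 1)) * (p' / Nat.gcd p' t) * l := by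
  letI := T.instFieldF; letI := T.instNumberFieldF; letI := T.instAlgebraF; letI := T.instFieldK
  letI := T.instNumberFieldK; letI := T.instAlgebraK; letI := T.instFieldFbar; letI := T.instAlgebraFbar
  letI := T.instAlgebraKFbar; letI := T.instIsElliptic
  haveI : Fact (pp : ℕ).Prime := ⟨pp.2⟩
  have hp : (pp : ℕ).Prime := pp.2
  intro x₀
  by_cases h1 : padicValRat pp ((((Cor22.jInv q₀)⁻¹ / ((pp : ℕ) : ℚ) ^ (2 * t)) ^ ((pp : ℕ) - 1) - 1)) = 1
  · rw [if_pos h1]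
    exact GenuineK.absRamificationIdx_kOf_eq_wildUnit_ratPoint T pp hpq hpl ht hpt hpole h1 x₀
  · rw [if_neg h1]
    -- the unit `u` has `v_p(u) = 0`, from the pole order at a place `v ∣ p`
    obtain ⟨v, hv⟩ : ∃ v : HeightOneSpectrum (𝓞 ℚ), Rat.HeightOneSpectrum.natGenerator v = pp :=
      ⟨(Rat.HeightOneSpectrum.primesEquiv (R := 𝓞 ℚ)).symm pp,
        congrArg (fun q : Nat.Primes => (q : ℕ)) ((Rat.HeightOneSpectrum.primesEquiv (R := 𝓞 ℚ)).apply_symm_apply pp)⟩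
    have hord := hpole v hv
    have ht0 : (0 : ℤ) < t := by exact_mod_cast ht
    have hj0 : Cor22.jInv q₀ ≠ 0 := fun h0 => by
      rw [h0, Literature.IUT.LogVolume.ord_zero] at hord
      linarith
    have hpQ : ((pp : ℕ) : ℚ) ≠ 0 := Nat.cast_ne_zero.mpr hp.ne_zero
    have hu0 : (Cor22.jInv q₀)⁻¹ / ((pp : ℕ) : ℚ) ^ (2 * t) ≠ 0 := div_ne_zero (inv_ne_zero hj0) (pow_ne_zero _ hpQ)
    have hu : padicValRat pp ((Cor22.jInv q₀)⁻¹ / ((pp : ℕ) : ℚ) ^ (2 * t)) = 0 := by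
      have hvj : padicValRat pp (Cor22.jInv q₀) = -(2 * (t : ℤ)) := by
        rw [← hv, ← GenuineK.ord_rat_eq_padicValRat v hj0]; exact hord
      rw [padicValRat.div (inv_ne_zero hj0) (pow_ne_zero _ hpQ), padicValRat.inv, hvj, padicValRat.pow,
        padicValRat.self hp.one_lt]
      push_cast; ring
    have hsplit : ((Cor22.jInv q₀)⁻¹ / ((pp : ℕ) : ℚ) ^ (2 * t)) ^ ((pp : ℕ) - 1) = 1 ∨
        2 ≤ padicValRat pp ((((Cor22.jInv q₀)⁻¹ / ((pp : ℕ) : ℚ) ^ (2 * t)) ^ ((pp : ℕ) - 1) - 1)) := by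
      rcases GenuineK.padicValRat_pow_sub_one_sub_one_of_padicValRat_eq_zero (p := (pp : ℕ)) hu0 hu with h | h
      · exact Or.inl h
      · right
        have h1' : padicValRat pp ((((Cor22.jInv q₀)⁻¹ / ((pp : ℕ) : ℚ) ^ (2 * t)) ^ ((pp : ℕ) - 1) - 1)) ≠ 1 := h1
        omega
    exact GenuineK.absRamificationIdx_kOf_eq_wildSplit_ratPoint T pp hpq hpl ht hpt hpole hsplit x₀

/-- **Wild ramification at a `p ∣ t` pole ⟺ the unit congruence FAILS: `p ∣ e(K_{x₀}/ℚ_p) ↔ v_p(u^{p−1} − 1) = 1`** (same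
setting): the Kummer class of the Tate parameter is non-trivial on the inertia group iff `q ∉ (ℚ_p^×)^p` iff
`u^{p−1} ≢ 1 (mod p²)` (Serre 1972 §1.12; Serre *Cours* II §3.3). [cite: Serre1972, §1.12] [cite: Serre1973, Ch. II §3.3]
[cite: Mochizuki2012, IUTchIV Thm. 1.10 p. 22] [claim: Mochizuki2012, status: disputed] -/
theorem GenuineK.prime_dvd_absRamificationIdx_kOf_iff_ratPoint {q₀ : ℚ} {l : ℕ} (T : Cor22.ThetaVolumeDatumAt (ratPoint q₀) l)
    (pp : Nat.Primes) {p' : ℕ} (hpq : ((pp : ℕ) = 3 ∧ p' = 5) ∨ ((pp : ℕ) = 5 ∧ p' = 3)) (hpl : (pp : ℕ) ≠ l)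
    {t : ℕ} (ht : 0 < t) (hpt : (pp : ℕ) ∣ t)
    (hpole : ∀ v : HeightOneSpectrum (𝓞 ℚ), Rat.HeightOneSpectrum.natGenerator v = pp →
      Literature.IUT.LogVolume.ord ℚ v (Cor22.jInv q₀) = -(2 * (t : ℤ))) :
    letI := T.instFieldF; letI := T.instNumberFieldF; letI := T.instAlgebraF; letI := T.instFieldK
    letI := T.instNumberFieldK; letI := T.instAlgebraK; letI := T.instFieldFbar; letI := T.instAlgebraFbar
    letI := T.instAlgebraKFbar; letI := T.instIsElliptic
    haveI : Fact (pp : ℕ).Prime := ⟨pp.2⟩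
    ∀ x₀ : (thetaIndex (pilotDataOfK T.D T.K)).Fibre (.inr pp),
      (pp : ℕ) ∣ absRamificationIdx (pp : ℕ) (kOf (pilotDataOfK T.D T.K) pp.1 x₀) ↔
        padicValRat pp ((((Cor22.jInv q₀)⁻¹ / ((pp : ℕ) : ℚ) ^ (2 * t)) ^ ((pp : ℕ) - 1) - 1)) = 1 := by
  letI := T.instFieldF; letI := T.instNumberFieldF; letI := T.instAlgebraF; letI := T.instFieldK
  letI := T.instNumberFieldK; letI := T.instAlgebraK; letI := T.instFieldFbar; letI := T.instAlgebraFbar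
  letI := T.instAlgebraKFbar; letI := T.instIsElliptic
  haveI : Fact (pp : ℕ).Prime := ⟨pp.2⟩
  have hp : (pp : ℕ).Prime := pp.2
  intro x₀
  have h := GenuineK.absRamificationIdx_kOf_eq_wild_ite_ratPoint T pp hpq hpl ht hpt hpole x₀
  -- the cofactor `(p′/gcd(p′,t))·l·(p−1)` is prime to `p`
  have hq : (p' / Nat.gcd p' t) ∣ p' := Nat.div_dvd_of_dvd (Nat.gcd_dvd_left p' t)
  have hcopq : Nat.Coprime (pp : ℕ) (p' / Nat.gcd p' t) := by
    refine Nat.Coprime.coprime_dvd_right hq ?_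
    rcases hpq with ⟨h3, h5⟩ | ⟨h5, h3⟩
    · rw [h3, h5]; norm_num
    · rw [h5, h3]; norm_num
  have hcopl : Nat.Coprime (pp : ℕ) l := (Nat.coprime_primes hp T.D.l_prime).mpr hpl
  have hcop1 : Nat.Coprime (pp : ℕ) (pp - 1) := by
    have h2 : 2 ≤ (pp : ℕ) := hp.two_le
    rw [Nat.coprime_self_sub_right (by omega)]
    exact Nat.coprime_one_right _
  constructor
  · intro hdvd
    by_contra hne
    rw [h, if_neg hne] at hdvd
    have h1 : (pp : ℕ) ∣ (pp - 1) * (p' / Nat.gcd p' t) :=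
      (Nat.Coprime.dvd_of_dvd_mul_right hcopl hdvd)
    have h2 : (pp : ℕ) ∣ (p' / Nat.gcd p' t) := Nat.Coprime.dvd_of_dvd_mul_left hcop1 h1
    have h3 : (pp : ℕ) ∣ 1 := by
      have := Nat.Coprime.eq_one_of_dvd hcopq h2
      omega
    exact hp.one_lt.ne' (Nat.dvd_one.mp h3)
  · intro h1
    rw [h, if_pos h1, mul_assoc, mul_assoc]
    exact dvd_mul_right _ _

end Summit.ABC.IUTFork.Conditional

end
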